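import Mathlib.Analysis.InnerProductSpace.Basic
import Literature.MathematicalPhysics.KineticTheory.HardSphereEuler
import HarnessLib

/-!
# The collision-difference mark `ψ_T` is bounded by `1` (line `Sketch` v8, crux
# `LambertianContactSwap.ContactAngleEquidistribution`, stmt-AtomisticToContinuum-12097; lead c5)

Helper file (`--supports stmt-AtomisticToContinuum-12097`, registered stub `stub_psiT_bound`). For a bounded
operator `T` on `ℝ³` with `‖T‖ ≤ 1` and the quadratic velocity observable `q_T(v) = ⟪v, T v⟫`, the collisional
change under the elastic reflection of the pair `(v, w)` along a direction `ω`,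
`Dq_T(v, w, ω) = q_T(v − ⟪v − w, ω⟫ω) + q_T(w + ⟪v − w, ω⟫ω) − q_T(v) − q_T(w)`, expands by bilinearity to
`−c⟪g, Tω⟫ − c⟪ω, Tg⟫ + 2c²⟪ω, Tω⟫` with `g = v − w`, `c = ⟪g, ω⟫` (`inner_reflPair_quadratic_sub`), hence
`|Dq_T(v, w, ω)| ≤ 4‖v − w‖²` whenever `‖ω‖ ≤ 1` (`abs_inner_reflPair_quadratic_sub_le`, Cauchy–Schwarz and
`‖T x‖ ≤ ‖T‖‖x‖`). The mark `ψ_T(s, x, v, w, n) = Dq_T(v, w, ‖n‖⁻¹n)/(12‖v − w‖²)` of the crux therefore satisfies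
`|ψ_T| ≤ 1/3 ≤ 1` (`stub_psiT_bound`); at `v = w` the prefactor `(12·0)⁻¹ = 0` and at `n = 0` the normal
`‖n‖⁻¹n = 0`, so no case distinction is needed beyond `‖‖n‖⁻¹ n‖ ≤ 1`.

References: folklore (elastic collision rule, e.g. C. Cercignani, R. Illner, M. Pulvirenti, *The Mathematical
Theory of Dilute Gases* (1994), §4.2).
-/

noncomputable section

open scoped RealInnerProductSpace

namespace Summit.AtomisticToContinuum.HydrodynamicLimit.Theorems.ContactAngleEquidistributionSketch

open Literature.MathematicalPhysics.KineticTheory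

/-- Bilinear expansion of the collisional change of the quadratic observable `q_T(v) = ⟪v, T v⟫` under the
reflection `(v, w) ↦ (v − cω, w + cω)`, `c = ⟪v − w, ω⟫`:
`Dq_T(v, w, ω) = −c⟪v − w, Tω⟫ − c⟪ω, T(v − w)⟫ + 2c²⟪ω, Tω⟫`. [folklore] -/
theorem inner_reflPair_quadratic_sub (T : V3 →L[ℝ] V3) (v w ω : V3) :
    ⟪v - ⟪v - w, ω⟫ • ω, T (v - ⟪v - w, ω⟫ • ω)⟫ + ⟪w + ⟪v - w, ω⟫ • ω, T (w + ⟪v - w, ω⟫ • ω)⟫ -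
        ⟪v, T v⟫ - ⟪w, T w⟫ =
      -(⟪v - w, ω⟫ * ⟪v - w, T ω⟫) - ⟪v - w, ω⟫ * ⟪ω, T (v - w)⟫ +
        2 * ⟪v - w, ω⟫ ^ 2 * ⟪ω, T ω⟫ := by
  simp only [map_sub, map_add, map_smul, inner_sub_left, inner_sub_right, inner_add_left, inner_add_right,
    real_inner_smul_left, real_inner_smul_right]
  ring

/-- The collisional change of `q_T(v) = ⟪v, T v⟫`, `‖T‖ ≤ 1`, along a direction `ω` with `‖ω‖ ≤ 1` is at most
`4‖v − w‖²` in absolute value: each of `c⟪g, Tω⟫`, `c⟪ω, Tg⟫` is bounded by `‖g‖²` and `c²⟪ω, Tω⟫` by `‖g‖²`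
(`g = v − w`, `c = ⟪g, ω⟫`, Cauchy–Schwarz and the operator-norm bound). [folklore] -/
theorem abs_inner_reflPair_quadratic_sub_le (T : V3 →L[ℝ] V3) (hT : ‖T‖ ≤ 1) (v w ω : V3)
    (hω : ‖ω‖ ≤ 1) :
    |⟪v - ⟪v - w, ω⟫ • ω, T (v - ⟪v - w, ω⟫ • ω)⟫ + ⟪w + ⟪v - w, ω⟫ • ω, T (w + ⟪v - w, ω⟫ • ω)⟫ -
        ⟪v, T v⟫ - ⟪w, T w⟫| ≤ 4 * ‖v - w‖ ^ 2 := by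
  rw [inner_reflPair_quadratic_sub]
  set g : V3 := v - w
  set c : ℝ := ⟪g, ω⟫
  have hg0 : 0 ≤ ‖g‖ := norm_nonneg g
  have hTω : ‖T ω‖ ≤ 1 :=
    (T.le_opNorm ω).trans ((mul_le_mul hT hω (norm_nonneg ω) zero_le_one).trans_eq (one_mul 1))
  have hTg : ‖T g‖ ≤ ‖g‖ :=
    (T.le_opNorm g).trans ((mul_le_mul_of_nonneg_right hT hg0).trans_eq (one_mul ‖g‖))
  have hc : |c| ≤ ‖g‖ :=
    (abs_real_inner_le_norm g ω).trans ((mul_le_mul_of_nonneg_left hω hg0).trans_eq (mul_one ‖g‖))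
  have h1 : |⟪g, T ω⟫| ≤ ‖g‖ :=
    (abs_real_inner_le_norm g (T ω)).trans ((mul_le_mul_of_nonneg_left hTω hg0).trans_eq (mul_one ‖g‖))
  have h2 : |⟪ω, T g⟫| ≤ ‖g‖ :=
    (abs_real_inner_le_norm ω (T g)).trans
      ((mul_le_mul hω hTg (norm_nonneg _) zero_le_one).trans_eq (one_mul ‖g‖))
  have h3 : |⟪ω, T ω⟫| ≤ 1 :=
    (abs_real_inner_le_norm ω (T ω)).trans
      ((mul_le_mul hω hTω (norm_nonneg _) zero_le_one).trans_eq (one_mul 1))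
  have hA : |c * ⟪g, T ω⟫| ≤ ‖g‖ ^ 2 := by
    rw [abs_mul, sq]
    exact mul_le_mul hc h1 (abs_nonneg _) hg0
  have hB : |c * ⟪ω, T g⟫| ≤ ‖g‖ ^ 2 := by
    rw [abs_mul, sq]
    exact mul_le_mul hc h2 (abs_nonneg _) hg0
  have hC : |c ^ 2 * ⟪ω, T ω⟫| ≤ ‖g‖ ^ 2 := by
    rw [abs_mul, abs_pow]
    exact (mul_le_mul (pow_le_pow_left₀ (abs_nonneg c) hc 2) h3 (abs_nonneg _) (sq_nonneg _)).trans_eq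
      (mul_one _)
  obtain ⟨hA₁, hA₂⟩ := abs_le.mp hA
  obtain ⟨hB₁, hB₂⟩ := abs_le.mp hB
  obtain ⟨hC₁, hC₂⟩ := abs_le.mp hC
  exact abs_le.mpr ⟨by linarith, by linarith⟩

/-- **`|ψ_T| ≤ 1`** (registered stub `stub_psiT_bound` of line `Sketch` v8): for `‖T‖ ≤ 1` the
collision-difference mark `ψ_T(s, x, v, w, n) = Dq_T(v, w, n̂)/(12‖v − w‖²)` of the quadratic observable
`q_T(v) = ⟪v, T v⟫` (`Dq_T(v, w, ω) = q_T(v − ⟪v−w, ω⟫ω) + q_T(w + ⟪v−w, ω⟫ω) − q_T(v) − q_T(w)`,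
`n̂ = ‖n‖⁻¹ n`) is bounded by `1` in absolute value: `|Dq_T(v, w, n̂)| ≤ 4‖v − w‖²` since `‖n̂‖ ≤ 1`
(`abs_inner_reflPair_quadratic_sub_le`), and `(12‖v − w‖²)⁻¹ · 4‖v − w‖² ≤ 1` (the value is `0` at `v = w`,
where the prefactor is `0⁻¹ = 0`, and at `n = 0`, where `n̂ = 0`). [folklore] -/
theorem stub_psiT_bound (T : V3 →L[ℝ] V3) (hT : ‖T‖ ≤ 1) :
    let refl : V3 → V3 × V3 → V3 × V3 := fun n p =>
      (p.1 - ⟪p.1 - p.2, n⟫ • n, p.2 + ⟪p.1 - p.2, n⟫ • n)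
    let Dq : V3 → V3 → V3 → ℝ := fun v w n =>
      ⟪(refl n (v, w)).1, T (refl n (v, w)).1⟫ + ⟪(refl n (v, w)).2, T (refl n (v, w)).2⟫ -
        ⟪v, T v⟫ - ⟪w, T w⟫
    let ψ : ℝ → T3 → V3 → V3 → V3 → ℝ := fun _ _ v w n =>
      (12 * ‖v - w‖ ^ 2)⁻¹ * Dq v w (‖n‖⁻¹ • n)
    ∀ s x v w n, |ψ s x v w n| ≤ 1 := by
  intro refl Dq ψ s x v w n
  have hω : ‖(‖n‖⁻¹ • n : V3)‖ ≤ 1 := by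
    rw [norm_smul, norm_inv, norm_norm, inv_mul_eq_div]
    exact div_self_le_one _
  have hD := abs_inner_reflPair_quadratic_sub_le T hT v w (‖n‖⁻¹ • n) hω
  have h12 : 0 ≤ 12 * ‖v - w‖ ^ 2 := by positivity
  show |(12 * ‖v - w‖ ^ 2)⁻¹ * (⟪v - ⟪v - w, ‖n‖⁻¹ • n⟫ • ‖n‖⁻¹ • n, T (v - ⟪v - w, ‖n‖⁻¹ • n⟫ • ‖n‖⁻¹ • n)⟫ +
      ⟪w + ⟪v - w, ‖n‖⁻¹ • n⟫ • ‖n‖⁻¹ • n, T (w + ⟪v - w, ‖n‖⁻¹ • n⟫ • ‖n‖⁻¹ • n)⟫ -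
        ⟪v, T v⟫ - ⟪w, T w⟫)| ≤ 1
  rw [abs_mul, abs_inv, abs_of_nonneg h12]
  exact inv_mul_le_one_of_le₀ (hD.trans (by nlinarith [sq_nonneg ‖v - w‖])) h12

end Summit.AtomisticToContinuum.HydrodynamicLimit.Theorems.ContactAngleEquidistributionSketch

end
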